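import Summits.CriticalPhenomena.PercolationContinuityZ3.Theorems.PercNearOneGluingNoHeavyPcintMemUniformTenData
import HarnessLib

/-!
# CriticalPhenomena/PercolationContinuityZ3 — Theorems/PercNearOneGluingNoHeavyPcintMemUniformTenStructD.lean: fast structural check of rows 4608–6191 of the memory-10 list (kernel)

Lane prim-pcint, STRUCTURE rule (prim-pcint-2 GEN 19).  `URowsOKF u10tab 10 6192 lo 192 = true` for the 192-row ranges of rows 4608–6191, each by one
`decide +kernel` (tuple-model check of …MemUniformChunkFast: every recorded successor is `mstep 10` of the row state up to the recorded
symmetry, indices `< 6192`), assembled as `structRows10D : URowsOKC perm6 u10tab 10 6192 4608 6192` by `urowsOKC_of_fast` + `permsOK_perm6`.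
Generated by numerics/emit_u10struct.py.

HONEST FRAMING: kernel evaluation of a finite check.  No `sorry`; standard axioms.  Written by prim-pcint-2 gen 19, 2026-08-26.
-/

namespace Summit.CriticalPhenomena.PercolationContinuityZ3.Theorems.Pcint

open Literature.Probability.Percolation Literature.Probability.LatticeModels

/-- Fast structural check of rows 4608–4799. [folklore] -/
theorem struct10_24 : URowsOKF u10tab 10 6192 4608 192 = true := by
  decide +kernel

/-- Fast structural check of rows 4800–4991. [folklore] -/
theorem struct10_25 : URowsOKF u10tab 10 6192 4800 192 = true := by
  decide +kernel

/-- Fast structural check of rows 4992–5183. [folklore] -/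
theorem struct10_26 : URowsOKF u10tab 10 6192 4992 192 = true := by
  decide +kernel

/-- Fast structural check of rows 5184–5375. [folklore] -/
theorem struct10_27 : URowsOKF u10tab 10 6192 5184 192 = true := by
  decide +kernel

/-- Fast structural check of rows 5376–5567. [folklore] -/
theorem struct10_28 : URowsOKF u10tab 10 6192 5376 192 = true := by
  decide +kernel

/-- Fast structural check of rows 5568–5759. [folklore] -/
theorem struct10_29 : URowsOKF u10tab 10 6192 5568 192 = true := by
  decide +kernel

/-- Fast structural check of rows 5760–5951. [folklore] -/
theorem struct10_30 : URowsOKF u10tab 10 6192 5760 192 = true := by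
  decide +kernel

/-- Fast structural check of rows 5952–6143. [folklore] -/
theorem struct10_31 : URowsOKF u10tab 10 6192 5952 192 = true := by
  decide +kernel

/-- Fast structural check of rows 6144–6191. [folklore] -/
theorem struct10_32 : URowsOKF u10tab 10 6192 6144 48 = true := by
  decide +kernel

/-- **Rows 4608–6191 of the memory-10 list are structurally valid.** [folklore] -/
theorem structRows10D : URowsOKC perm6 u10tab 10 6192 4608 6192 :=
  (urowsOKC_append perm6 u10tab (urowsOKC_append perm6 u10tab (urowsOKC_append perm6 u10tab (urowsOKC_append perm6 u10tab (urowsOKC_append perm6 u10tab (urowsOKC_append perm6 u10tab (urowsOKC_append perm6 u10tab (urowsOKC_append perm6 u10tab (urowsOKC_of_fast u10tab permsOK_perm6 struct10_24) (urowsOKC_of_fast u10tab permsOK_perm6 struct10_25)) (urowsOKC_of_fast u10tab permsOK_perm6 struct10_26)) (urowsOKC_of_fast u10tab permsOK_perm6 struct10_27)) (urowsOKC_of_fast u10tab permsOK_perm6 struct10_28)) (urowsOKC_of_fast u10tab permsOK_perm6 struct10_29)) (urowsOKC_of_fast u10tab permsOK_perm6 struct10_30)) (urowsOKC_of_fast u10tab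 permsOK_perm6 struct10_31)) (urowsOKC_of_fast u10tab permsOK_perm6 struct10_32))

end Summit.CriticalPhenomena.PercolationContinuityZ3.Theorems.Pcint
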